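import Summits.BirchSwinnertonDyer.BirchSwinnertonDyer.Theorems.SylvesterTwoHeegnerIndexCoupledDescentFirstLayerOfL1
import Literature.NumberTheory.DiophantineGeometry.Conductor
import HarnessLib

/-!
# `stub_firstLayerFour` of VARIANT K from leaf (L1) ALONE (the height display is the route's own fact)

Crux `UpperOffV0HSYPlus` (stmt-BirchSwinnertonDyer-19804), skeleton VARIANT K
(`Cruxes/UpperOffV0HSYPlus/Lines/coupled_variantK.lean` 9a39a679fe96c65a), stub `stub_firstLayerFour`:
`PublishedFactsTwoPlus → ∀ p ≡ 4 (9) prime, 3 ∉ 𝔽_p^{×3} → ∀ minimal models A ≅ E_{3p²}, B ≅ E_p →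
∀ qB qA, #Ш_an(B) = qB → #Ш_an(A) = qA → qB·qA ≠ 0 → ord₂(qB·qA) = 0 → #Ш(B)[2^∞] = #Ш(A)[2^∞] = 1`.

`firstLayerFour_of_L1` proves the stub's statement VERBATIM from ONE displayed family: leaf (L1) of
THEOREM K2's kernel deduction (p620148) — the coupled Kolyvagin classes `c_A(ℓ) ∈ H¹(K, E_{3p²}[2])`,
`c_B(ℓℓ′) ∈ H¹(K, E_p[2])` Selmer off their level with the two FLIP criteria at `λ ∋ ℓ` — over every
quadratic `K ∋ ω` and for EVERY non-`2`-divisible bottom point `Y₀ ∈ E_p(K)` (by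
`…BottomClassInvariance.hL1_of_hL1` all such `Y₀` are interchangeable), with the Kolyvagin primes
`ℓ ∤ 2·N(E_{3p²})·N(E_p)·d_K`, `(ℓ)` inert, `Frob ℓ = Frob ∞` on `K(E_{3p²}[2])`, `K(E_p[2])`
(levels = the conductors).  The height display is NOT a hypothesis: it is the last conjunct of
`PublishedFactsTwoPlus` (Hu–Shu–Yin's `shaAnPair_mul_height_eq_two_zpow_mul_height`, `i = 0` on
`p ≡ 4 (9)`), read at `K = ℚ(ζ₃) = CyclotomicField 3 ℚ`; its point `Y` is opaque (`∃`), which is why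
(L1) is asked for every non-divisible `Y₀` — the display's point is one of them by Thm B′
(`not_exists_two_smul_eq_of_padicValRat_eq`). Then `…FirstLayerOfL1` (p646146).
So after this file `stub_firstLayerFour` ⟸ (L1) for one non-divisible CM bottom point + «that point is
not 2-divisible» (m(p) = 0), and nothing else. Theorem-only; the stub is NOT closed (its hypothesis
(L1) is research: memo two §57.3 FLIP LEMMA); no label moves; BSD not claimed for any curve.
-/

set_option linter.dupNamespace false -- Summits modules are `Summit.<Summit>.<Problem>…` by design

noncomputable section

open scoped Classical
open WeierstrassCurve WeierstrassCurve.Affine WeierstrassCurve.Affine.Point NumberField IsDedekindDomain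
open Field Literature.NumberTheory.EllipticCurves Literature.NumberTheory.GaloisRepresentations
open Literature.NumberTheory.EllipticCurves.HuShuYin2019
open Summit.BirchSwinnertonDyer.BirchSwinnertonDyer.Theses.SylvesterTwoHeegnerIndex
  hiding HSYPointTwoDivisibleSevenModNine

namespace Summit.BirchSwinnertonDyer.BirchSwinnertonDyer.Theorems.SylvesterTwoCoupledDescentCebotarev

open SylvesterTwoCoupledDescentPrimitivity

/-- **`stub_firstLayerFour` ⟸ leaf (L1) for every non-`2`-divisible bottom point** (levels = the
conductors of the short models; `K` any quadratic field with `ω`).  The conclusion after `→` is the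
registered stub's statement VERBATIM. -/
theorem firstLayerFour_of_L1
    (hL1 : ∀ (p : ℕ), p.Prime → p % 9 = 4 → (¬ ∃ x : ZMod p, x ^ 3 = 3) →
      ∀ (K : Type) [Field K] [NumberField K] (ω : K), ω ^ 2 + ω + 1 = 0 →
        Module.finrank ℚ K = 2 →
      ∀ Y₀ : ((cubeSumCurve (p : ℚ)).baseChange K).toAffine.Point,
        (¬ ∃ Q : ((cubeSumCurve (p : ℚ)).baseChange K).toAffine.Point, (2 : ℕ) • Q = Y₀) →
      ∃ (cA : ℕ → galH1Torsion ((cubeSumCurve (3 * (p : ℚ) ^ 2)).baseChange K) (2 : ℕ))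
        (cB : ℕ → galH1Torsion ((cubeSumCurve (p : ℚ)).baseChange K) (2 : ℕ)),
      (∀ ℓ, (ℓ.Prime ∧ ¬ ℓ ∣ (cubeSumCurve (3 * (p : ℚ) ^ 2)).conductorNorm ℤ ∧
          ¬ ℓ ∣ (cubeSumCurve (p : ℚ)).conductorNorm ℤ ∧ ¬ ((ℓ : ℤ) ∣ NumberField.discr K) ∧ ℓ ≠ 2 ∧
          (Ideal.span {(ℓ : 𝓞 K)}).IsPrime ∧
          FrobEqFrobInfty (cubeSumCurve (3 * (p : ℚ) ^ 2)) K 2 ℓ ∧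
          FrobEqFrobInfty (cubeSumCurve (p : ℚ)) K 2 ℓ) →
        (∀ v : HeightOneSpectrum (𝓞 K), (ℓ : 𝓞 K) ∉ v.asIdeal →
          cA ℓ ∈ selmerLocalKer ((cubeSumCurve (3 * (p : ℚ) ^ 2)).baseChange K)
            (v.adicCompletion K) (2 : ℕ)) ∧
        (∀ x : InfinitePlace K, cA ℓ ∈ selmerLocalKer
          ((cubeSumCurve (3 * (p : ℚ) ^ 2)).baseChange K) x.Completion (2 : ℕ)) ∧
        (∀ v : HeightOneSpectrum (𝓞 K), (ℓ : 𝓞 K) ∈ v.asIdeal →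
          (cA ℓ ∈ selmerLocalKer ((cubeSumCurve (3 * (p : ℚ) ^ 2)).baseChange K)
              (v.adicCompletion K) (2 : ℕ) ↔
            kummerClassOfPoint (cubeSumCurve (p : ℚ)) K Nat.prime_two Y₀ ∈
              ((cubeSumCurve (p : ℚ)).baseChange K).torsionLocalKer (v.adicCompletion K) (2 : ℕ)))) ∧
      (∀ ℓ ℓ', (ℓ.Prime ∧ ¬ ℓ ∣ (cubeSumCurve (3 * (p : ℚ) ^ 2)).conductorNorm ℤ ∧
          ¬ ℓ ∣ (cubeSumCurve (p : ℚ)).conductorNorm ℤ ∧ ¬ ((ℓ : ℤ) ∣ NumberField.discr K) ∧ ℓ ≠ 2 ∧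
          (Ideal.span {(ℓ : 𝓞 K)}).IsPrime ∧
          FrobEqFrobInfty (cubeSumCurve (3 * (p : ℚ) ^ 2)) K 2 ℓ ∧
          FrobEqFrobInfty (cubeSumCurve (p : ℚ)) K 2 ℓ) →
        (ℓ'.Prime ∧ ¬ ℓ' ∣ (cubeSumCurve (3 * (p : ℚ) ^ 2)).conductorNorm ℤ ∧
          ¬ ℓ' ∣ (cubeSumCurve (p : ℚ)).conductorNorm ℤ ∧ ¬ ((ℓ' : ℤ) ∣ NumberField.discr K) ∧
          ℓ' ≠ 2 ∧ (Ideal.span {(ℓ' : 𝓞 K)}).IsPrime ∧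
          FrobEqFrobInfty (cubeSumCurve (3 * (p : ℚ) ^ 2)) K 2 ℓ' ∧
          FrobEqFrobInfty (cubeSumCurve (p : ℚ)) K 2 ℓ') → ℓ ≠ ℓ' →
        (∀ v : HeightOneSpectrum (𝓞 K), (ℓ : 𝓞 K) ∉ v.asIdeal → (ℓ' : 𝓞 K) ∉ v.asIdeal →
          cB (ℓ * ℓ') ∈ selmerLocalKer ((cubeSumCurve (p : ℚ)).baseChange K)
            (v.adicCompletion K) (2 : ℕ)) ∧
        (∀ x : InfinitePlace K,
          cB (ℓ * ℓ') ∈ selmerLocalKer ((cubeSumCurve (p : ℚ)).baseChange K) x.Completion (2 : ℕ)) ∧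
        (∀ v : HeightOneSpectrum (𝓞 K), (ℓ : 𝓞 K) ∈ v.asIdeal →
          (cB (ℓ * ℓ') ∈ selmerLocalKer ((cubeSumCurve (p : ℚ)).baseChange K)
              (v.adicCompletion K) (2 : ℕ) ↔
            cA ℓ' ∈ ((cubeSumCurve (3 * (p : ℚ) ^ 2)).baseChange K).torsionLocalKer
              (v.adicCompletion K) (2 : ℕ))))) :
    PublishedFactsTwoPlus →
    ∀ (p : ℕ), p.Prime → p % 9 = 4 → (¬ ∃ x : ZMod p, x ^ 3 = 3) →
      ∀ (A B : WeierstrassCurve ℚ) [A.IsElliptic] [A.IsGloballyMinimal] [B.IsElliptic]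
        [B.IsGloballyMinimal], (∃ C : VariableChange ℚ, C • B = HuShuYin2019.cubeSumCurve (p : ℚ)) →
        (∃ C : VariableChange ℚ, C • A = HuShuYin2019.cubeSumCurve (3 * (p : ℚ) ^ 2)) →
        ∀ (qB qA : ℚ), shaAn B = (qB : ℂ) → shaAn A = (qA : ℂ) → qB * qA ≠ 0 →
          padicValRat 2 (qB * qA) = 0 →
          Nat.card (AddCommGroup.primaryComponent B.sha 2) = 1 ∧
            Nat.card (AddCommGroup.primaryComponent A.sha 2) = 1 := by
  intro hF p hp h4 h3 A B _ _ _ _ hB hA qB qA hqB hqA hne hv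
  -- the CM field `K = ℚ(ζ₃)` with `ω = ζ₃`
  haveI : IsCyclotomicExtension {3} ℚ (CyclotomicField 3 ℚ) :=
    CyclotomicField.isCyclotomicExtension 3 ℚ
  obtain ⟨ω, hω⟩ : ∃ ω : CyclotomicField 3 ℚ, ω ^ 2 + ω + 1 = 0 :=
    ⟨_, SylvesterTwoCMNormForm.sq_add_self_add_one_eq_zero_of_isPrimitiveRoot
      (IsCyclotomicExtension.zeta_spec 3 ℚ (CyclotomicField 3 ℚ))⟩
  have h2 : Module.finrank ℚ (CyclotomicField 3 ℚ) = 2 :=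
    SylvesterTwoCMNormForm.finrank_cyclotomicField_three
  -- the display (last conjunct of `PublishedFactsTwoPlus`) at `K`, `i = 0`
  obtain ⟨qB', qA', hqB', hqA', hne', hrank, P, Y, hP, hgen, hid⟩ :=
    hF.2 p hp (Or.inl h4) h3 A B hB hA (CyclotomicField 3 ℚ) ω hω h2
  have eB : qB' = qB := by exact_mod_cast hqB'.symm.trans hqB
  have eA : qA' = qA := by exact_mod_cast hqA'.symm.trans hqA
  rw [if_pos h4, eB, eA] at hid
  have hv0 : padicValRat 2 (qB * qA) = (0 : ℤ) := by exact_mod_cast hv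
  obtain ⟨CB, hCB⟩ := hB
  obtain ⟨CA, hCA⟩ := hA
  have hp3 : p % 3 = 1 := by omega
  have hp2 : p ≠ 2 := by rintro rfl; norm_num at h4
  have hp0 : (p : ℚ) ≠ 0 := by exact_mod_cast hp.ne_zero
  have h3p0 : (3 * (p : ℚ) ^ 2) ≠ 0 := mul_ne_zero (by norm_num) (pow_ne_zero 2 hp0)
  haveI := Rank1Residual.X12.CubeSumFamilies.isElliptic_cubeSumCurve hp0
  haveI := Rank1Residual.X12.CubeSumFamilies.isElliptic_cubeSumCurve h3p0
  -- levels = conductors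
  haveI : NeZero ((cubeSumCurve (p : ℚ)).conductorNorm ℤ) :=
    ⟨(conductorNorm_pos_holds (cubeSumCurve (p : ℚ))).ne'⟩
  haveI : NeZero ((cubeSumCurve (3 * (p : ℚ) ^ 2)).conductorNorm ℤ) :=
    ⟨(conductorNorm_pos_holds (cubeSumCurve (3 * (p : ℚ) ^ 2))).ne'⟩
  -- the transported point `Y₀` is not `2`-divisible (Thm B′ bookkeeping on `B`, then transport)
  set Y₀ := Affine.Point.congrEquiv
      (congrArg (fun W : WeierstrassCurve ℚ ↦ W.baseChange (CyclotomicField 3 ℚ)) hCB)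
      (VariableChange.pointEquivBaseChange B CB (CyclotomicField 3 ℚ) Y) with hY₀
  have hc : (2 * ω + 1) ^ 2 = algebraMap ℚ (CyclotomicField 3 ℚ) (-3) := by
    rw [map_neg, map_ofNat]; linear_combination 4 * hω
  have hθ₀ : 2 * ω + 1 ∉ Set.range (algebraMap ℚ (CyclotomicField 3 ℚ)) := by
    rintro ⟨r, hr⟩
    have h1 : algebraMap ℚ (CyclotomicField 3 ℚ) (r ^ 2) = algebraMap ℚ _ (-3) := by
      rw [map_pow, hr, hc]
    have h3' : r ^ 2 = -3 := (algebraMap ℚ (CyclotomicField 3 ℚ)).injective h1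
    nlinarith [sq_nonneg r]
  have hYnd : ¬ ∃ Q : (B.baseChange (CyclotomicField 3 ℚ)).toAffine.Point, (2 : ℕ) • Q = Y :=
    not_exists_two_smul_eq_of_padicValRat_eq h2 hθ₀ hc hω hp hp2 B CB hCB hrank hP hgen Y
      (by exact_mod_cast hne) hid hv0
  have hY₀nd : ¬ ∃ Q : ((cubeSumCurve (p : ℚ)).baseChange (CyclotomicField 3 ℚ)).toAffine.Point,
      (2 : ℕ) • Q = Y₀ := by
    rintro ⟨Q, hQ⟩
    set ψ := (VariableChange.pointEquivBaseChange B CB (CyclotomicField 3 ℚ)).trans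
      (Affine.Point.congrEquiv
        (congrArg (fun W : WeierstrassCurve ℚ ↦ W.baseChange (CyclotomicField 3 ℚ)) hCB)) with hψ
    have hYψ : Y₀ = ψ Y := by rw [hY₀, hψ, AddEquiv.trans_apply]
    refine hYnd ⟨ψ.symm Q, ψ.injective ?_⟩
    rw [map_nsmul, AddEquiv.apply_symm_apply, hQ, hYψ]
  -- the first-layer assembly
  exact natCard_primaryComponent_sha_eq_one_pair_of_display_of_L1 h2 hω hp hp3 A B CA CB hCA hCB
    hrank hP hgen Y (by exact_mod_cast hne) hid hv0 dvd_rfl dvd_rfl Y₀ hY₀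
    (hL1 p hp h4 h3 (CyclotomicField 3 ℚ) ω hω h2 Y₀ hY₀nd)

end Summit.BirchSwinnertonDyer.BirchSwinnertonDyer.Theorems.SylvesterTwoCoupledDescentCebotarev

end
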